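import Summits.BirchSwinnertonDyer.BirchSwinnertonDyer.Theses.SignedBaseChange
import Literature.NumberTheory.EllipticCurves.BurungaleCastellaSkinner2025.GreenbergBDPComparisonGoodReduction
import Literature.NumberTheory.EllipticCurves.BurungaleCastellaSkinner2025.BDPMainConjecture
import Literature.NumberTheory.EllipticCurves.SupersingularDensitySerreFrobeniusProofs
import Literature.NumberTheory.EllipticCurves.NonEisensteinPrimeOfSurjective
import Summits.BirchSwinnertonDyer.Rank1Residual.Partition.IrreducibleOverQuadraticField
import HarnessLib

/-!
# Stub S3 `stub_minusIsBDP` of line `bdpline` on the crux `AnticyclotomicEisensteinDivisibility`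
# (stmt-BirchSwinnertonDyer-20727, route SignedBaseChange) — the SUPERSINGULAR form, closed modulo the
# REFEREED comparison of Burungale–Castella–Skinner 2025 instead of the BSTW preprint binder (helper)

Lead prover seat `bsd-line-sbc-p1` (gen 10). POINTWISE COPY of the width seat's
`SignedBaseChangeAcDivMinusIsBDPSS.stub_minusIsBDP_ss_of_facts` (p630219, file
`…MinusIsBDPSupersingular.lean`) with ONE hypothesis exchanged: the preprint binder
`BurungaleSkinnerTianWan2024.prop627_span_minus_eq_span_bdp_supersingular_PRE` (BSTW arXiv:2409.01350 Prop.
6.27 (i), conjunct 8 of `stub_namedFactsSS` in skeleton v33) is replaced by the refereed named fact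
`BurungaleCastellaSkinner2025.proofProp422_span_minus_eq_span_bdp_goodReduction` (IMRN 2025, proof of
Prop. 4.2.2: at every prime `p > 2` of GOOD reduction the anticyclotomic projection of `L_p^Gr(g/K)` generates
the same ideal as `L_p^BDP(g/K)`, via [CGS23, Prop. 1.4.5]; flag `BCS-422-comparison-via-CGS` in that file).
The refereed fact asks in addition for (irr_K) and `2 < p`, both available among the stub's binders
((irr_K) from `Surj` by `Rank1Residual.irrK_of_surj`, `2 < p` from `5 ≤ p`). Conclusion and every other line
of the proof unchanged: a BDP frame from `BurungaleCastellaSkinner2025.prop422_exists_isBDPLFunction_mu_eq_zero`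
(conjunct 10) and the comparison `(minus G) = (J₀ L)` for it. Purpose: skeleton v34 re-sources conjunct 8
from the preprint to the refereed sentence. Theorems only; the two facts are hypotheses; no summit statement
/ BSD is proved by this file.
-/

-- D-0017: single-problem summit, the namespace repeats the problem name by design.
set_option linter.dupNamespace false
set_option autoImplicit false

noncomputable section

namespace Summit.BirchSwinnertonDyer.BirchSwinnertonDyer.Theorems.SignedBaseChangeAcDivMinusIsBDPSSBCS

open Summit.BirchSwinnertonDyer.BirchSwinnertonDyer.Theses.SignedBaseChange
open NumberField IsDedekindDomain Field CongruenceSubgroup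
  Literature.NumberTheory.EllipticCurves Literature.NumberTheory.EllipticCurves.YanZhu2026
  Literature.NumberTheory.EllipticCurves.BurungaleCastellaSkinner2025
  Literature.NumberTheory.EllipticCurves.Rank1Residual

/-- **Stub S3 `stub_minusIsBDP` at a good SUPERSINGULAR prime (`a_p = 0`), modulo two REFEREED named facts**:
BCS25 proof of Prop. 4.2.2 (the comparison `(G⁻) = (J₀ L)` for every Greenberg frame and every BDP frame at every
good `p > 2`, via CGS23 Prop. 1.4.5) and BCS25 Prop. 4.2.2 (a BDP frame with `μ = 0` exists). The registered text
with `W.frobeniusTrace p = 0 →` inserted after `W.HasGoodReductionAtPrime p →`; (irr_K) from `Surj`. Pointwise copy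
of `SignedBaseChangeAcDivMinusIsBDPSS.stub_minusIsBDP_ss_of_facts` with the preprint binder replaced.
[cite: BurungaleCastellaSkinner2025, Prop. 4.2.2 and its proof (§4.2, p. 9 of arXiv:2405.00270v2)]
[cite: CastellaGrossiSkinner2025, Prop. 2.4.5] -/
theorem stub_minusIsBDP_ss_of_bcs
    (hbcs : proofProp422_span_minus_eq_span_bdp_goodReduction)
    (h422e : prop422_exists_isBDPLFunction_mu_eq_zero) :
    SignedTwoVariableInputs → Literature.NumberTheory.EllipticCurves.ModularForms.nonempty_modularParametrizationData → ∀ (W : WeierstrassCurve ℚ) [W.IsElliptic] [W.IsGloballyMinimal] (p : ℕ) [Fact p.Prime], 5 ≤ p → W.HasGoodReductionAtPrime p → W.frobeniusTrace p = 0 → Literature.NumberTheory.EllipticCurves.Rank1Residual.Surj W p → ∀ (K : Type) [Field K] [NumberField K] (ι : PadicAlgCl p ≃+* ℂ) (v vbar : IsDedekindDomain.HeightOneSpectrum (NumberField.RingOfIntegers K)) (κ₁ κ₂ : Literature.NumberTheory.EllipticCurves.ZpExtension K p) (γ₁ γ₂ : Field.absoluteGaloisGroup K) [Fact (Literature.NumberTheory.EllipticCurves.ZpExtension.IsTopGeneratorPair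 κ₁ κ₂ γ₁ γ₂)] [NeZero (NumberField.discr K).natAbs] (N : ℕ) [NeZero N] (f : CuspForm (CongruenceSubgroup.Gamma0 N) 2), Literature.NumberTheory.EllipticCurves.ModularForms.IsNewformOf W f → (N : ℤ) = W.conductorNorm ℤ → Literature.NumberTheory.EllipticCurves.IsImaginaryQuadratic K → ((Ideal.span {(p : ℤ)}).primesOver (NumberField.RingOfIntegers K)).ncard = 2 → ((p : ℕ) : NumberField.RingOfIntegers K) ∈ v.asIdeal → ((p : ℕ) : NumberField.RingOfIntegers K) ∈ vbar.asIdeal → vbar ≠ v → (∀ (w : NumberField.InfinitePlace K) (k : NumberField.RingOfIntegers K), k ∈ v.asIdeal ↔ ‖ι.symm (w.embedding (k : K))‖ < 1) → IsCoprime (N : ℤ) (NumberField.discr K) → (∀ ℓ : ℕ, ℓ.Prime → ℓ ∣ N → ((Ideal.span {(ℓ : ℤ)}).primesOver (NumberField.RingOfIntegers K)).ncard = 2) → Odd (NumberField.discr K) → NumberField.discr K ≠ -3 → κ₁.IsCyclotomic → κ₂.IsAnticyclotomic → ∀ (Ω δ : ℂ) (Ωp : (Literature.NumberTheory.EllipticCurves.unrIntegers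 p)ˣ) (LK G : PowerSeries (PowerSeries (PadicComplexInt p))), Ω ≠ 0 → (δ ^ 2 = (NumberField.discr K : ℂ) ∨ δ ^ 2 = -(NumberField.discr K : ℂ)) → Literature.NumberTheory.EllipticCurves.IsKatzMeasure₂ ι v vbar ∅ κ₁ κ₂ γ₁⁻¹ γ₂⁻¹ 1 Ω δ ((Ωp : Literature.NumberTheory.EllipticCurves.unrIntegers p) : PadicComplex p) LK → Literature.NumberTheory.EllipticCurves.IsGreenbergLFunctionAnyRoot₂ ι v vbar κ₁ κ₂ γ₁⁻¹ γ₂⁻¹ f (NumberField.discr K).natAbs (NumberField.classNumber K) LK G → ∃ (ΩK : ℂ) (Ωp' : (Literature.NumberTheory.EllipticCurves.unrIntegers p)ˣ) (L : Literature.NumberTheory.EllipticCurves.UnrSeries p), ΩK ≠ 0 ∧ Literature.NumberTheory.EllipticCurves.IsBDPLFunction ι v κ₂ γ₂ f ΩK ((Ωp' : Literature.NumberTheory.EllipticCurves.unrIntegers p) : PadicComplex p) L ∧ ∀ (J₀ : Literature.NumberTheory.EllipticCurves.unrIntegers p →+* PadicComplexInt p), (∀ x : Literature.NumberTheory.EllipticCurves.unrIntegers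 p, ((J₀ x : PadicComplexInt p) : PadicComplex p) = (x : PadicComplex p)) → Ideal.span {Literature.NumberTheory.EllipticCurves.UnrSeries₂.minus G} = Ideal.span {PowerSeries.map J₀ L} := by
  intro _ _ W _ _ p _ hp hgood ha0 hs K _ _ ι v vbar κ₁ κ₂ γ₁ γ₂ _ _ N _ f hf hN hK hsplit hv hvbar hvv hι hcop hHeeg
    hodd hne3 hκ₁ hκ₂ Ω δ Ωp LK G hΩ hδ hLK hG
  have hirr : (W.baseChange K).HasIrreducibleModPGaloisRep p :=
    Summit.BirchSwinnertonDyer.Rank1Residual.irrK_of_surj W p hs K hK.1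
  -- a BDP frame at the good prime `p` (BCS25 Prop. 4.2.2 / Hsieh Thm. B)
  obtain ⟨ΩK, Ωp', L, hΩK, hL, -⟩ := h422e ι W K v κ₂ γ₂ hf (by omega) hgood hK hHeeg hsplit hodd hne3 hirr hv hι hκ₂
    (isTopGenerator_of_pair (κ₁ := κ₁) (γ₁ := γ₁))
  refine ⟨ΩK, Ωp', L, hΩK, hL, fun J₀ hJ₀ ↦ ?_⟩
  -- good reduction at `p > 2`: BCS25 proof of Prop. 4.2.2 (the comparison), with (irr_K) from `Surj`
  exact hbcs ι W K v vbar κ₁ κ₂ γ₁ γ₂ hf hN (by omega) hgood hK hHeeg hsplit hodd hne3 hcop hirr hv hvbar hvv hι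
    hκ₁ hκ₂ Ω δ Ωp LK G hΩ hδ hLK hG ΩK Ωp' L hΩK hL J₀ hJ₀

end Summit.BirchSwinnertonDyer.BirchSwinnertonDyer.Theorems.SignedBaseChangeAcDivMinusIsBDPSSBCS

end
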